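import Literature.AlgebraicGeometry.Motives.ProjBaseChangeAny
import Literature.AlgebraicGeometry.Motives.UniversalHyperplaneSectionChart
import Literature.AlgebraicGeometry.Limits.ProjectiveSubschemeDescent
import HarnessLib

/-!
# Specialising homogeneous equations from the generic to a closed fibre of `ℙᴺ × B → B`

For a field `k`, a `k`-scheme `B`, an affine open `U = Spec A ⊆ B` and `ℙᴺ = ℙᴺ_k`, the open piece
`ℙᴺ × U` of `ℙᴺ ×ₖ B` IS the projective space `ℙᴺ_A = Proj A[x₀, …, x_N]` over the ring `A`
(`ℙᴺ_A = ℙᴺ_k ×_k Spec A`, Liu 2002 Ex. 3.1.10, the tree's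
`ProjBaseChangeRing.isPullback_projMap'`): this file realises that identification as the open
immersion `openPiece : ℙᴺ_A ⟶ ℙᴺ ×ₖ B` (`pullback.lift` of `ℙᴺ_A → ℙᴺ_k` and `ℙᴺ_A → Spec A = U ⊆ B`;
a base change of `U ↪ B`, `isPullback_openPiece`), together with

* the **slice** `slice r : ℙᴺ_k ⟶ ℙᴺ ×ₖ B` at a `k`-point `Spec k → U` given by a `k`-algebra
  retraction `r : A → k` (`= Proj` of the reduction `A[x] → k[x]` followed by `openPiece`): a base
  change of `Spec k → B` (`isPullback_slice`), with `slice ≫ pr₁ = 𝟙` and image the fibre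
  `pr₂⁻¹(b)`, a closed immersion when `b` is a closed point (`isClosedImmersion_slice`);
* the **specialisation lemma** `map_mem_asHomogeneousIdeal_of_mem_closure`: for an `A`-algebra `K`
  (the function field) and a point `λ'` of `ℙᴺ_K`, if a point `w = slice r p` of the fibre over `b`
  lies in the closure of (the image in `ℙᴺ ×ₖ B` of) `λ'`, then every form `μ ∈ A[x]` whose image
  in `K[x]` vanishes at `λ'` has reduction `r(μ) ∈ k[x]` vanishing at `p = pr₁ w`. In `ℙᴺ_A` this is
  the tautology "`closure {λ} = V₊(𝔭_λ)` and `Proj` of a graded map acts on points by pulling back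
  homogeneous primes" (`ProjectiveSpectrum.map_mem_of_mem_closure`); the content is the transport
  to `ℙᴺ ×ₖ B` along `openPiece` (an embedding) and `slice`.

This is the mechanism by which equations with coefficients regular at `b ∈ B` that hold on the
generic fibre of a family of subvarieties of `ℙᴺ` parametrised by `B` continue to hold on the
special fibre over `b` ("limits of lines are lines": Tian–Zong 2014, proof of Prop. 7.2; Kollár,
*Rational curves on algebraic varieties*, II.2; Fulton, *Intersection Theory*, §10.1). Everything is
proved; no named facts.

## References

* [Liu2002] Q. Liu, *Algebraic Geometry and Arithmetic Curves*, Prop. 3.1.9, Ex. 3.1.10.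
* [TianZong2014] Z. Tian, H. R. Zong, *One-cycles on rationally connected varieties*, Compositio
  Math. 150 (2014), proof of Prop. 7.2.
* [Fulton1998] W. Fulton, *Intersection Theory*, §10.1 (families of cycles over a curve).
-/

noncomputable section

open CategoryTheory CategoryTheory.Limits AlgebraicGeometry MonoidalCategory MvPolynomial
  TopologicalSpace

universe u

namespace Literature.AlgebraicGeometry.Motives

attribute [local instance] MvPolynomial.gradedAlgebra MvPolynomial.algebraMvPolynomial
  Literature.AlgebraicGeometry.Motives.ProjBaseChange.algebraBase

/-! ### The tautology on `Proj` of polynomial rings -/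

namespace ProjectiveSpectrum

open ProjBaseChangeRing

variable {A K K' : Type u} [CommRing A] [CommRing K] [CommRing K'] [Algebra A K] [Algebra A K']
  {n : ℕ}

/-- `Proj` of the base-change map `A[x] → K[x]` acts on points by pulling back homogeneous primes:
`μ ∈ 𝔭_{π(x)} ↔ μ ⊗ 1 ∈ 𝔭_x` (Mathlib `Proj.map`, by construction; `Iff.rfl`). [folklore] -/
theorem mem_asHomogeneousIdeal_map_iff (x : ↥(Proj (homogeneousSubmodule (Fin (n + 1)) K)))
    (μ : MvPolynomial (Fin (n + 1)) A) :
    μ ∈ _root_.ProjectiveSpectrum.asHomogeneousIdeal (𝒜 := homogeneousSubmodule (Fin (n + 1)) A)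
        ((Proj.map (mapGraded A K (Fin (n + 1))) (irrelevant_le_map A K (Fin (n + 1)))).base x) ↔
      MvPolynomial.map (algebraMap A K) μ ∈
        _root_.ProjectiveSpectrum.asHomogeneousIdeal (𝒜 := homogeneousSubmodule (Fin (n + 1)) K) x :=
  Iff.rfl

/-- The closure of a point of `Proj` is the zero locus of its homogeneous prime. [folklore] -/
theorem closure_singleton_eq_zeroLocus' {R : Type u} [CommRing R]
    (x : ↥(Proj (homogeneousSubmodule (Fin (n + 1)) R))) :
    closure ({x} : Set ↥(Proj (homogeneousSubmodule (Fin (n + 1)) R))) =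
      _root_.ProjectiveSpectrum.zeroLocus (homogeneousSubmodule (Fin (n + 1)) R)
        (_root_.ProjectiveSpectrum.asHomogeneousIdeal
          (𝒜 := homogeneousSubmodule (Fin (n + 1)) R) x : Set (MvPolynomial (Fin (n + 1)) R)) := by
  set P : _root_.ProjectiveSpectrum (homogeneousSubmodule (Fin (n + 1)) R) := x with hP
  have key : closure ({P} : Set (_root_.ProjectiveSpectrum (homogeneousSubmodule (Fin (n + 1)) R))) =
      _root_.ProjectiveSpectrum.zeroLocus _ (P.asHomogeneousIdeal : Set (MvPolynomial (Fin (n + 1)) R)) := by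
    ext z
    rw [← _root_.ProjectiveSpectrum.le_iff_mem_closure, ← _root_.ProjectiveSpectrum.as_ideal_le_as_ideal,
      _root_.ProjectiveSpectrum.mem_zeroLocus]
    rfl
  exact key

/-- **Specialisation of homogeneous equations (tautological form).** For `A`-algebras `K`, `K'`,
a point `λ'` of `ℙᴺ_K` and a point `p` of `ℙᴺ_{K'}` whose image in `ℙᴺ_A` lies in the closure of
the image of `λ'`: every `μ ∈ A[x]` with `μ ⊗_A K ∈ 𝔭_{λ'}` has `μ ⊗_A K' ∈ 𝔭_p`. [folklore] -/
theorem map_mem_of_mem_closure (lam : ↥(Proj (homogeneousSubmodule (Fin (n + 1)) K)))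
    (p : ↥(Proj (homogeneousSubmodule (Fin (n + 1)) K')))
    (h : (Proj.map (mapGraded A K' (Fin (n + 1))) (irrelevant_le_map A K' (Fin (n + 1)))).base p ∈
      closure {(Proj.map (mapGraded A K (Fin (n + 1))) (irrelevant_le_map A K (Fin (n + 1)))).base
        lam})
    {μ : MvPolynomial (Fin (n + 1)) A}
    (hμ : MvPolynomial.map (algebraMap A K) μ ∈
      _root_.ProjectiveSpectrum.asHomogeneousIdeal (𝒜 := homogeneousSubmodule (Fin (n + 1)) K) lam) :
    MvPolynomial.map (algebraMap A K') μ ∈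
      _root_.ProjectiveSpectrum.asHomogeneousIdeal (𝒜 := homogeneousSubmodule (Fin (n + 1)) K') p := by
  rw [closure_singleton_eq_zeroLocus'] at h
  exact (mem_asHomogeneousIdeal_map_iff p μ).1 (h ((mem_asHomogeneousIdeal_map_iff lam μ).2 hμ))

end ProjectiveSpectrum

/-! ### The open piece `ℙᴺ_A = ℙᴺ × Spec A ⊆ ℙᴺ ×ₖ B` -/

namespace ProjFamily

open ProjBaseChangeRing

open UniversalHyperplaneSection (sectionsAlgebra fromSpec_comp_hom algebraMap_sections)

variable {k : Type u} [Field k] (N : ℕ) (B : SchemeOver k) {U : B.left.Opens} (hU : IsAffineOpen U)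

attribute [local instance] UniversalHyperplaneSection.sectionsAlgebra

local notation "𝓐" R => homogeneousSubmodule (Fin (N + 1)) R

/-- `ℙᴺ_A → ℙᴺ_k`, `Proj` of the scalar extension `k[x] → A[x]`, `A = Γ(B, U)`. [folklore] -/
abbrev toP : Proj (𝓐 Γ(B.left, U)) ⟶ (projectiveSpace N k).left :=
  Proj.map (mapGraded k Γ(B.left, U) (Fin (N + 1))) (irrelevant_le_map k Γ(B.left, U) (Fin (N + 1)))

/-- **The open piece `ℙᴺ_A ⟶ ℙᴺ ×ₖ B`** (`A = Γ(B, U)`, `U` affine): the morphism into the product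
with components `ℙᴺ_A → ℙᴺ_k` and `ℙᴺ_A → Spec A = U ⊆ B`. [cite: Liu2002, Ex. 3.1.10] -/
def openPiece : Proj (𝓐 Γ(B.left, U)) ⟶ ((projectiveSpace N k) ⊗ B).left :=
  pullback.lift (toP N B (U := U)) (projToSpec (Fin (N + 1)) Γ(B.left, U) ≫ hU.fromSpec) (by
    rw [Category.assoc, fromSpec_comp_hom, ← algebraMap_sections]
    exact (isPullback_projMap' k Γ(B.left, U) (n := N)).w)

/-- `openPiece ≫ pr₁ = (ℙᴺ_A → ℙᴺ_k)`. [folklore] -/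
@[simp]
theorem openPiece_fst :
    openPiece N B hU ≫ (CartesianMonoidalCategory.fst (projectiveSpace N k) B).left =
      toP N B (U := U) :=
  pullback.lift_fst _ _ _

/-- `openPiece ≫ pr₂ = (ℙᴺ_A → Spec A = U ⊆ B)`. [folklore] -/
@[simp]
theorem openPiece_snd :
    openPiece N B hU ≫ (CartesianMonoidalCategory.snd (projectiveSpace N k) B).left =
      projToSpec (Fin (N + 1)) Γ(B.left, U) ≫ hU.fromSpec :=
  pullback.lift_snd _ _ _

/-- **`ℙᴺ_A` is the open piece `ℙᴺ × U` of `ℙᴺ ×ₖ B`**: the square `openPiece`, `ℙᴺ_A → Spec A`,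
`pr₂`, `U ↪ B` is cartesian (paste `ℙᴺ_A = ℙᴺ_k ×_k Spec A` with `ℙᴺ ×ₖ B = ℙᴺ_k ×_k B`).
[cite: Liu2002, Ex. 3.1.10] -/
theorem isPullback_openPiece :
    IsPullback (openPiece N B hU) (projToSpec (Fin (N + 1)) Γ(B.left, U))
      (CartesianMonoidalCategory.snd (projectiveSpace N k) B).left hU.fromSpec := by
  have hbig := isPullback_projMap' k Γ(B.left, U) (n := N)
  rw [algebraMap_sections, ← fromSpec_comp_hom hU] at hbig
  have hprod : IsPullback (CartesianMonoidalCategory.fst (projectiveSpace N k) B).left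
      (CartesianMonoidalCategory.snd (projectiveSpace N k) B).left (projectiveSpace N k).hom B.hom :=
    IsPullback.of_hasPullback (projectiveSpace N k).hom B.hom
  refine IsPullback.of_right ?_ (openPiece_snd N B hU) hprod
  rw [openPiece_fst]
  exact hbig

/-- The open piece is an open immersion (a base change of `U ↪ B`). [folklore] -/
instance isOpenImmersion_openPiece : IsOpenImmersion (openPiece N B hU) :=
  MorphismProperty.of_isPullback (isPullback_openPiece N B hU).flip inferInstance

/-- The open piece covers exactly `pr₂⁻¹(U)`. [folklore] -/
theorem range_openPiece :
    Set.range (openPiece N B hU).base =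
      (CartesianMonoidalCategory.snd (projectiveSpace N k) B).left.base ⁻¹' (U : Set B.left) := by
  rw [Literature.AlgebraicGeometry.Limits.range_fst_of_isPullback (isPullback_openPiece N B hU), IsAffineOpen.range_fromSpec]

/-- For an `A`-algebra `K` compatible with `k` (`k → A → K` a scalar tower), a morphism
`ℙᴺ_K → ℙᴺ ×ₖ B` with components `ℙᴺ_K → ℙᴺ_k` and `ℙᴺ_K → Spec K → Spec A = U ⊆ B` factors as
`ℙᴺ_K → ℙᴺ_A → ℙᴺ ×ₖ B` (uniqueness of maps to a product). [folklore] -/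
theorem eq_map_comp_openPiece {K : Type u} [CommRing K] [Algebra k K] [Algebra Γ(B.left, U) K]
    [IsScalarTower k Γ(B.left, U) K] (ι : Proj (𝓐 K) ⟶ ((projectiveSpace N k) ⊗ B).left)
    (h₁ : ι ≫ (CartesianMonoidalCategory.fst (projectiveSpace N k) B).left =
      Proj.map (mapGraded k K (Fin (N + 1))) (irrelevant_le_map k K (Fin (N + 1))))
    (h₂ : ι ≫ (CartesianMonoidalCategory.snd (projectiveSpace N k) B).left =
      projToSpec (Fin (N + 1)) K ≫ Spec.map (CommRingCat.ofHom (algebraMap Γ(B.left, U) K)) ≫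
        hU.fromSpec) :
    ι = Proj.map (mapGraded Γ(B.left, U) K (Fin (N + 1))) (irrelevant_le_map Γ(B.left, U) K _) ≫
      openPiece N B hU := by
  set π' := Proj.map (mapGraded Γ(B.left, U) K (Fin (N + 1))) (irrelevant_le_map Γ(B.left, U) K _)
    with hπ'
  have e₁ : openPiece N B hU ≫ pullback.fst (projectiveSpace N k).hom B.hom = toP N B (U := U) :=
    pullback.lift_fst _ _ _
  have e₂ : openPiece N B hU ≫ pullback.snd (projectiveSpace N k).hom B.hom =
      projToSpec (Fin (N + 1)) Γ(B.left, U) ≫ hU.fromSpec :=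
    pullback.lift_snd _ _ _
  have hw := (isPullback_projMap' Γ(B.left, U) K (n := N)).w
  -- `ℙᴺ_K → ℙᴺ_k` factors through `ℙᴺ_A`
  have hfac : Proj.map (mapGraded k K (Fin (N + 1))) (irrelevant_le_map k K (Fin (N + 1))) =
      π' ≫ toP N B (U := U) := by
    have hcomp : Proj.map (mapGraded k K (Fin (N + 1))) (irrelevant_le_map k K (Fin (N + 1))) =
        Proj.map ((mapGraded Γ(B.left, U) K (Fin (N + 1))).comp (mapGraded k Γ(B.left, U) (Fin (N + 1))))
          (HomogeneousIdeal.irrelevant_le_map_comp (irrelevant_le_map k Γ(B.left, U) (Fin (N + 1)))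
            (irrelevant_le_map Γ(B.left, U) K (Fin (N + 1)))) := by
      congr 1
      ext p : 1
      change MvPolynomial.map (algebraMap k K) p =
        MvPolynomial.map (algebraMap Γ(B.left, U) K) (MvPolynomial.map (algebraMap k Γ(B.left, U)) p)
      rw [MvPolynomial.map_map, ← IsScalarTower.algebraMap_eq]
    exact hcomp.trans (Proj.map_comp _ _ _ _)
  have e₁' : π' ≫ toP N B (U := U) = (π' ≫ openPiece N B hU) ≫ pullback.fst (projectiveSpace N k).hom B.hom :=
    (congrArg (π' ≫ ·) e₁.symm).trans (Category.assoc _ _ _).symm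
  have e₂' : π' ≫ (projToSpec (Fin (N + 1)) Γ(B.left, U) ≫ hU.fromSpec) =
      (π' ≫ openPiece N B hU) ≫ pullback.snd (projectiveSpace N k).hom B.hom :=
    (congrArg (π' ≫ ·) e₂.symm).trans (Category.assoc _ _ _).symm
  have hw' : projToSpec (Fin (N + 1)) K ≫ Spec.map (CommRingCat.ofHom (algebraMap Γ(B.left, U) K)) ≫
      hU.fromSpec = π' ≫ (projToSpec (Fin (N + 1)) Γ(B.left, U) ≫ hU.fromSpec) :=
    ((Category.assoc _ _ _).symm.trans (congrArg (· ≫ hU.fromSpec) hw.symm)).trans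
      (Category.assoc _ _ _)
  apply pullback.hom_ext
  · exact (h₁.trans hfac).trans e₁'
  · exact (h₂.trans hw').trans e₂'

/-! ### The slice at a `k`-point of `U` -/

-- A `k`-point of `U = Spec A` is an `A`-algebra structure on `k` (evaluation `r : A → k`); for the
-- slice to be a section of `pr₁` it must be a retraction of the scalars (`hret` below).
variable [Algebra Γ(B.left, U) k]

/-- `Proj` of the reduction `A[x] → k[x]` along the evaluation `A → k`: `ℙᴺ_k → ℙᴺ_A`. [folklore] -/
abbrev reduce : (projectiveSpace N k).left ⟶ Proj (𝓐 Γ(B.left, U)) :=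
  Proj.map (mapGraded Γ(B.left, U) k (Fin (N + 1))) (irrelevant_le_map Γ(B.left, U) k (Fin (N + 1)))

/-- `Proj.map` of a graded homomorphism equal to the identity is the identity. [folklore] -/
theorem projMap_eq_id_of_eq {R : Type u} [CommRing R]
    (φ : (𝓐 R) →+*ᵍ (𝓐 R)) (hφ : ∀ p, φ p = p)
    (h : HomogeneousIdeal.irrelevant (𝓐 R) ≤ (HomogeneousIdeal.irrelevant (𝓐 R)).map φ) :
    Proj.map φ h = 𝟙 _ := by
  have hid : φ = GradedRingHom.id (𝓐 R) := by
    ext p : 1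
    exact hφ p
  subst hid
  exact Proj.map_id

/-- `(ℙᴺ_k → ℙᴺ_A) ≫ (ℙᴺ_A → ℙᴺ_k) = 𝟙` when the evaluation is a retraction of the scalars: it is
`Proj` of `k[x] → A[x] → k[x] = id`. [folklore] -/
theorem reduce_toP (hret : ∀ c : k, algebraMap Γ(B.left, U) k (algebraMap k Γ(B.left, U) c) = c) :
    reduce N B ≫ toP N B (U := U) = 𝟙 _ := by
  change Proj.map _ _ ≫ Proj.map _ _ = _
  rw [← Proj.map_comp]
  refine projMap_eq_id_of_eq N _ (fun p => ?_) _
  change MvPolynomial.map (algebraMap Γ(B.left, U) k) (MvPolynomial.map (algebraMap k Γ(B.left, U)) p)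
    = p
  rw [MvPolynomial.map_map]
  have hcomp : (algebraMap Γ(B.left, U) k).comp (algebraMap k Γ(B.left, U)) = RingHom.id k := by
    ext c
    exact hret c
  rw [hcomp, MvPolynomial.map_id]

/-- **The slice** `ℙᴺ_k ⟶ ℙᴺ ×ₖ B` at the `k`-point of `U` given by the evaluation `A → k`:
reduction `ℙᴺ_k → ℙᴺ_A` followed by the open piece. [folklore] -/
def slice : (projectiveSpace N k).left ⟶ ((projectiveSpace N k) ⊗ B).left :=
  reduce N B ≫ openPiece N B hU

/-- The `k`-point `Spec k → Spec A = U ⊆ B` of `B` given by the evaluation `A → k`. [folklore] -/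
def pt : Spec (.of k) ⟶ B.left :=
  Spec.map (CommRingCat.ofHom (algebraMap Γ(B.left, U) k)) ≫ hU.fromSpec

/-- `slice ≫ pr₁ = 𝟙` (for a retraction). [folklore] -/
theorem slice_fst (hret : ∀ c : k, algebraMap Γ(B.left, U) k (algebraMap k Γ(B.left, U) c) = c) :
    slice N B hU ≫ (CartesianMonoidalCategory.fst (projectiveSpace N k) B).left = 𝟙 _ := by
  rw [slice, Category.assoc, openPiece_fst, reduce_toP N B hret]

/-- `slice ≫ pr₂ = (ℙᴺ_k → Spec k) ≫ pt`. [folklore] -/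
theorem slice_snd :
    slice N B hU ≫ (CartesianMonoidalCategory.snd (projectiveSpace N k) B).left =
      (projectiveSpace N k).hom ≫ pt B hU := by
  have hw := (isPullback_projMap' Γ(B.left, U) k (n := N)).w
  have s1 : slice N B hU ≫ (CartesianMonoidalCategory.snd (projectiveSpace N k) B).left =
      reduce N B ≫ (projToSpec (Fin (N + 1)) Γ(B.left, U) ≫ hU.fromSpec) :=
    (Category.assoc _ _ _).trans (congrArg (reduce N B ≫ ·) (openPiece_snd N B hU))
  have s2 : reduce N B ≫ (projToSpec (Fin (N + 1)) Γ(B.left, U) ≫ hU.fromSpec) =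
      (projToSpec (Fin (N + 1)) k ≫ Spec.map (CommRingCat.ofHom (algebraMap Γ(B.left, U) k))) ≫
        hU.fromSpec :=
    (Category.assoc _ _ _).symm.trans (congrArg (· ≫ hU.fromSpec) hw)
  exact (s1.trans s2).trans (Category.assoc _ _ _)

/-- `pr₁ (slice p) = p` (for a retraction). [folklore] -/
theorem fst_slice_apply (hret : ∀ c : k, algebraMap Γ(B.left, U) k (algebraMap k Γ(B.left, U) c) = c)
    (p : ↥(projectiveSpace N k).left) :
    (CartesianMonoidalCategory.fst (projectiveSpace N k) B).left.base (slice N B hU p) = p := by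
  rw [← Scheme.Hom.comp_apply, slice_fst N B hU hret]
  rfl

/-- **The slice is the fibre**: the square `slice`, `ℙᴺ_k → Spec k`, `pr₂`, `pt` is cartesian
(paste `ℙᴺ_k = ℙᴺ_A ×_A Spec k` with `ℙᴺ_A = (ℙᴺ ×ₖ B) ×_B U`). [folklore] -/
theorem isPullback_slice :
    IsPullback (slice N B hU) (projectiveSpace N k).hom
      (CartesianMonoidalCategory.snd (projectiveSpace N k) B).left (pt B hU) :=
  (isPullback_projMap' Γ(B.left, U) k (n := N)).paste_horiz (isPullback_openPiece N B hU)

/-- The slice covers exactly the fibre of `pr₂` over the point `b = pt(∗)`. [folklore] -/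
theorem range_slice :
    Set.range (slice N B hU).base =
      (CartesianMonoidalCategory.snd (projectiveSpace N k) B).left.base ⁻¹'
        Set.range (pt B hU).base :=
  Literature.AlgebraicGeometry.Limits.range_fst_of_isPullback (isPullback_slice N B hU)

/-- A point of `ℙᴺ ×ₖ B` lying over a point in the image of `pt` is a value of the slice, namely
the slice of its first projection (for a retraction). [folklore] -/
theorem eq_slice_fst_of_snd_mem
    (hret : ∀ c : k, algebraMap Γ(B.left, U) k (algebraMap k Γ(B.left, U) c) = c)
    {w : ↥((projectiveSpace N k) ⊗ B).left}
    (hw : (CartesianMonoidalCategory.snd (projectiveSpace N k) B).left.base w ∈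
      Set.range (pt B hU).base) :
    w = slice N B hU ((CartesianMonoidalCategory.fst (projectiveSpace N k) B).left.base w) := by
  obtain ⟨p, rfl⟩ : w ∈ Set.range (slice N B hU).base := by rw [range_slice]; exact hw
  rw [fst_slice_apply N B hU hret]

/-- The point `pt` is a preimmersion when the evaluation `A → k` is surjective (a closed immersion
`Spec k → Spec A` followed by an open immersion). [folklore] -/
theorem isPreimmersion_pt (hr : Function.Surjective (algebraMap Γ(B.left, U) k)) :
    IsPreimmersion (pt B hU) := by
  haveI : IsClosedImmersion (Spec.map (CommRingCat.ofHom (algebraMap Γ(B.left, U) k))) :=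
    IsClosedImmersion.spec_of_surjective _ hr
  exact IsPreimmersion.comp _ _

/-- If `b = pt(∗)` is a closed point of `B`, the point `pt : Spec k → B` is a closed immersion.
[folklore] -/
theorem isClosedImmersion_pt (hr : Function.Surjective (algebraMap Γ(B.left, U) k))
    (hb : IsClosed (Set.range (pt B hU).base)) : IsClosedImmersion (pt B hU) := by
  haveI := isPreimmersion_pt B hU hr
  exact IsClosedImmersion.of_isPreimmersion _ hb

/-- **The slice over a closed point is a closed immersion** (a base change of `pt`). [folklore] -/
theorem isClosedImmersion_slice (hr : Function.Surjective (algebraMap Γ(B.left, U) k))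
    (hb : IsClosed (Set.range (pt B hU).base)) : IsClosedImmersion (slice N B hU) := by
  haveI := isClosedImmersion_pt B hU hr hb
  exact MorphismProperty.of_isPullback (isPullback_slice N B hU).flip inferInstance

/-! ### Specialising equations from the generic fibre to the fibre over `b` -/

/-- **Specialisation of homogeneous equations along `ℙᴺ ×ₖ B → B`.** Let `K` be an `A`-algebra
(`A = Γ(B, U)`; typically the function field of `B`) and `λ'` a point of `ℙᴺ_K`, with image
`λ = openPiece (π λ') ∈ ℙᴺ ×ₖ B`. If a point `w` of the fibre of `pr₂` over `b = pt(∗)` lies in the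
closure of `λ`, then every `μ ∈ A[x₀, …, x_N]` whose scalar extension `μ ⊗_A K` lies in the
homogeneous prime of `λ'` has reduction `r(μ) ∈ k[x₀, …, x_N]` in the homogeneous prime of
`pr₁ w ∈ ℙᴺ_k` — equations with coefficients regular at `b` which hold generically hold on the
special fibre. [cite: TianZong2014, proof of Prop. 7.2] [cite: Fulton1998, §10.1] -/
theorem map_mem_asHomogeneousIdeal_of_mem_closure
    (hret : ∀ c : k, algebraMap Γ(B.left, U) k (algebraMap k Γ(B.left, U) c) = c)
    {K : Type u} [CommRing K]
    [Algebra Γ(B.left, U) K] (lam : ↥(Proj (𝓐 K))) {w : ↥((projectiveSpace N k) ⊗ B).left}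
    (hb : (CartesianMonoidalCategory.snd (projectiveSpace N k) B).left.base w ∈
      Set.range (pt B hU).base)
    (hw : w ∈ closure {openPiece N B hU
      ((Proj.map (mapGraded Γ(B.left, U) K (Fin (N + 1)))
        (irrelevant_le_map Γ(B.left, U) K (Fin (N + 1)))).base lam)})
    {μ : MvPolynomial (Fin (N + 1)) Γ(B.left, U)}
    (hμ : MvPolynomial.map (algebraMap Γ(B.left, U) K) μ ∈
      ProjectiveSpectrum.asHomogeneousIdeal (𝒜 := 𝓐 K) lam) :
    MvPolynomial.map (algebraMap Γ(B.left, U) k) μ ∈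
      ProjectiveSpectrum.asHomogeneousIdeal (𝒜 := 𝓐 k)
        ((CartesianMonoidalCategory.fst (projectiveSpace N k) B).left.base w) := by
  set p := (CartesianMonoidalCategory.fst (projectiveSpace N k) B).left.base w with hp
  have hwp : w = slice N B hU p := eq_slice_fst_of_snd_mem N B hU hret hb
  -- transport the closure along the embedding `openPiece`
  have hcl : reduce N B p ∈ closure {(Proj.map (mapGraded Γ(B.left, U) K (Fin (N + 1)))
      (irrelevant_le_map Γ(B.left, U) K (Fin (N + 1)))).base lam} := by
    rw [(openPiece N B hU).isOpenEmbedding.isInducing.closure_eq_preimage_closure_image,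
      Set.image_singleton, Set.mem_preimage]
    change (reduce N B ≫ openPiece N B hU).base p ∈ _
    rw [← slice, ← hwp]
    exact hw
  exact ProjectiveSpectrum.map_mem_of_mem_closure lam p hcl hμ

end ProjFamily

end Literature.AlgebraicGeometry.Motives

end
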